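import Mathlib
import Summits.MatrixMultiplication.MatrixMultiplication.Theorems.FidelityWitnessesFidelityThesisSepMajorantSingleProduct

/-!
# Line `separable-majorant` for crux `FidelityWitnesses.FidelityThesis` (stmt-MatrixMultiplication-4956) —
stub `stub_orthogonalFrameAdditivity`: ORTHOGONAL FRAME ADDITIVITY

Conventions (tree `matMulTensor`): slots `a = (κ,ν)` (output), `b = (κ,μ)`, `c = (μ',ν)` in `Fin n × Fin n`,
`⟨n,n,n⟩(a,b,c) = [a.1 = b.1 ∧ b.2 = c.1 ∧ a.2 = c.2]`.

Statement.  Let `S = Σ_{l<r} w_l ⊗ u_l ⊗ v_l` with PAIRWISE ORTHOGONAL input products `x_l = u_l ⊗ v_l`,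
i.e. `⟨x_l, x_l'⟩ = ⟨u_l, u_l'⟩ ⟨v_l, v_l'⟩ = 0` for `l ≠ l'`.  Then `|⟨S, ⟨n,n,n⟩⟩|² ≤ r · ‖S‖²`: `r` orthogonal
products capture at most `r` of the `n³` units of `⟨n,n,n⟩`, for every `n, r` (calibration `Λ = r` on
orthonormal frames; contains the route's `RankTwoAdditivity` on orthogonal pairs).

Proof.  This is the `A = 1` case of the frame conditioning law (`stub_frameConditioningLaw`), proved here
directly by the same weighted Cauchy–Schwarz route so that the file imports toolkit I only.  For an orthogonal
product family, Pythagoras gives `‖Σ_l d_l u_l ⊗ v_l‖² = Σ_l |d_l|² N_l`, `N_l = ‖u_l‖² ‖v_l‖²`, for all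
coefficients `d` (`sepMajorantOFA_pythagoras`; proved in `ℂ` by expanding `‖z‖² = conj z · z`, exchanging the
slot sums `(b,c)` with the frame sums `(l,l')`, factoring `Σ_{b,c} conj(u_l(b) v_l(c)) u_l'(b) v_l'(c) =
⟨u_l,u_l'⟩ ⟨v_l,v_l'⟩`, and killing the off-diagonal terms with orthogonality).  Then, slice by slice,
`⟨S, ⟨n,n,n⟩⟩ = Σ_a Σ_l w_l(a) t_l(a)` with `t_l(a) = (U_l V_l)_a` (`sepMajorant_frame_pairing`); termwise
`(|w_l(a)| |t_l(a)|)² ≤ (|w_l(a)|² N_l) · (|t_l(a)|² / N_l)`, so two nested applications of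
`Finset.sum_sq_le_sum_mul_sum_of_sq_le_mul` give `|⟨S,⟨n,n,n⟩⟩|² ≤ (Σ_{a,l} |w_l(a)|² N_l) · (Σ_{a,l} |t_l(a)|²/N_l)`;
Pythagoras on each output slice identifies the first factor with `‖S‖²`, and the single-product law
(`sepMajorant_singleProductLaw`: `Σ_a |t_l(a)|² ≤ N_l`) bounds the second by `r`.
Idea card `Cruxes/FidelityThesis/Ideas/separable-majorant-law.md`, § Why it bites (2).  Supports item
`stmt-MatrixMultiplication-4956`; no definitions.
-/

namespace Summit.MatrixMultiplication.MatrixMultiplication.Theorems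

open scoped BigOperators ComplexConjugate
open Literature.Computability.AlgebraicComplexity

/-- Frame coefficients of a vector in a product span: pairing `conj (u_l ⊗ v_l)` against
`y = Σ_{l'} d_{l'} u_{l'} ⊗ v_{l'}` slot by slot gives `Σ_{l'} d_{l'} ⟨u_l, u_{l'}⟩ ⟨v_l, v_{l'}⟩`. [folklore] -/
theorem sepMajorantOFA_frame_coefficient {n r : ℕ} (d : Fin r → ℂ) (u v : Fin r → Fin n × Fin n → ℂ)
    (l : Fin r) :
    ∑ b, ∑ c, conj (u l b) * conj (v l c) * ∑ l', d l' * u l' b * v l' c =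
      ∑ l', d l' * ((∑ b, conj (u l b) * u l' b) * ∑ c, conj (v l c) * v l' c) := by
  -- adapted from `inner_frame_slice` (Cruxes/DiagonalPowerDecay/Lines/frame_negativity_singlet_fraction)
  calc ∑ b, ∑ c, conj (u l b) * conj (v l c) * ∑ l', d l' * u l' b * v l' c
      = ∑ b, ∑ c, ∑ l', d l' * (conj (u l b) * u l' b * (conj (v l c) * v l' c)) := by
        refine Finset.sum_congr rfl fun b _ => Finset.sum_congr rfl fun c _ => ?_
        rw [Finset.mul_sum]
        exact Finset.sum_congr rfl fun l' _ => by ring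
    _ = ∑ b, ∑ l', ∑ c, d l' * (conj (u l b) * u l' b * (conj (v l c) * v l' c)) :=
        Finset.sum_congr rfl fun b _ => Finset.sum_comm
    _ = ∑ l', ∑ b, ∑ c, d l' * (conj (u l b) * u l' b * (conj (v l c) * v l' c)) := Finset.sum_comm
    _ = ∑ l', d l' * ((∑ b, conj (u l b) * u l' b) * ∑ c, conj (v l c) * v l' c) := by
        refine Finset.sum_congr rfl fun l' _ => ?_
        rw [Fintype.sum_mul_sum, Finset.mul_sum]
        exact Finset.sum_congr rfl fun b _ => by rw [Finset.mul_sum]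

/-- For a pairwise orthogonal product family (`⟨u_l, u_{l'}⟩ ⟨v_l, v_{l'}⟩ = 0` for `l ≠ l'`) only the
diagonal frame coefficient survives: `⟨u_l ⊗ v_l, Σ_{l'} d_{l'} u_{l'} ⊗ v_{l'}⟩ = d_l ⟨u_l,u_l⟩ ⟨v_l,v_l⟩`.
[folklore] -/
theorem sepMajorantOFA_frame_coefficient_orth {n r : ℕ} (d : Fin r → ℂ)
    (u v : Fin r → Fin n × Fin n → ℂ)
    (horth : ∀ l l' : Fin r, l ≠ l' →
      (∑ b, conj (u l b) * u l' b) * (∑ c, conj (v l c) * v l' c) = 0) (l : Fin r) :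
    ∑ b, ∑ c, conj (u l b) * conj (v l c) * ∑ l', d l' * u l' b * v l' c =
      d l * ((∑ b, conj (u l b) * u l b) * ∑ c, conj (v l c) * v l c) := by
  rw [sepMajorantOFA_frame_coefficient d u v l]
  refine Finset.sum_eq_single l (fun l' _ hne => ?_) (fun h => absurd (Finset.mem_univ l) h)
  rw [horth l l' (Ne.symm hne), mul_zero]

/-- Hermitian form of Pythagoras for a pairwise orthogonal product family:
`Σ_{b,c} conj(y(b,c)) y(b,c) = Σ_l conj(d_l) d_l ⟨u_l,u_l⟩ ⟨v_l,v_l⟩` for `y = Σ_l d_l u_l ⊗ v_l`. [folklore] -/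
theorem sepMajorantOFA_pythagoras_conj {n r : ℕ} (d : Fin r → ℂ) (u v : Fin r → Fin n × Fin n → ℂ)
    (horth : ∀ l l' : Fin r, l ≠ l' →
      (∑ b, conj (u l b) * u l' b) * (∑ c, conj (v l c) * v l' c) = 0) :
    ∑ b, ∑ c, conj (∑ l, d l * u l b * v l c) * ∑ l, d l * u l b * v l c =
      ∑ l, conj (d l) * d l * ((∑ b, conj (u l b) * u l b) * ∑ c, conj (v l c) * v l c) := by
  -- adapted from `parseval_slice` (Cruxes/DiagonalPowerDecay/Lines/frame_negativity_singlet_fraction)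
  calc ∑ b, ∑ c, conj (∑ l, d l * u l b * v l c) * ∑ l, d l * u l b * v l c
      = ∑ b, ∑ c, ∑ l, conj (d l) *
          (conj (u l b) * conj (v l c) * ∑ l', d l' * u l' b * v l' c) := by
        refine Finset.sum_congr rfl fun b _ => Finset.sum_congr rfl fun c _ => ?_
        rw [map_sum, Finset.sum_mul]
        exact Finset.sum_congr rfl fun l _ => by simp only [map_mul]; ring
    _ = ∑ b, ∑ l, ∑ c, conj (d l) *
          (conj (u l b) * conj (v l c) * ∑ l', d l' * u l' b * v l' c) :=
        Finset.sum_congr rfl fun b _ => Finset.sum_comm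
    _ = ∑ l, ∑ b, ∑ c, conj (d l) *
          (conj (u l b) * conj (v l c) * ∑ l', d l' * u l' b * v l' c) := Finset.sum_comm
    _ = ∑ l, conj (d l) * ∑ b, ∑ c, conj (u l b) * conj (v l c) * ∑ l', d l' * u l' b * v l' c := by
        refine Finset.sum_congr rfl fun l _ => ?_
        rw [Finset.mul_sum]
        exact Finset.sum_congr rfl fun b _ => by rw [Finset.mul_sum]
    _ = ∑ l, conj (d l) * d l * ((∑ b, conj (u l b) * u l b) * ∑ c, conj (v l c) * v l c) := by
        refine Finset.sum_congr rfl fun l _ => ?_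
        rw [sepMajorantOFA_frame_coefficient_orth d u v horth l, mul_assoc]

/-- **Pythagoras for a pairwise orthogonal product family.**  If `⟨u_l, u_{l'}⟩ ⟨v_l, v_{l'}⟩ = 0` for
`l ≠ l'`, then `‖Σ_l d_l u_l ⊗ v_l‖² = Σ_l |d_l|² ‖u_l‖² ‖v_l‖²` for all coefficients `d` — the frame
hypothesis of `stub_frameConditioningLaw` with `A = 1`, with equality. [folklore] -/
theorem sepMajorantOFA_pythagoras {n r : ℕ} (d : Fin r → ℂ) (u v : Fin r → Fin n × Fin n → ℂ)
    (horth : ∀ l l' : Fin r, l ≠ l' →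
      (∑ b, conj (u l b) * u l' b) * (∑ c, conj (v l c) * v l' c) = 0) :
    ∑ b, ∑ c, ‖∑ l, d l * u l b * v l c‖ ^ 2 =
      ∑ l, ‖d l‖ ^ 2 * ((∑ b, ‖u l b‖ ^ 2) * ∑ c, ‖v l c‖ ^ 2) := by
  have hC := sepMajorantOFA_pythagoras_conj d u v horth
  simp_rw [Complex.conj_mul'] at hC
  exact_mod_cast hC

/-- **Orthogonal frame additivity.**  If the `r` input products `u_l ⊗ v_l` of `S = Σ_l w_l ⊗ u_l ⊗ v_l` are
pairwise orthogonal (`⟨u_l, u_{l'}⟩ · ⟨v_l, v_{l'}⟩ = 0` for `l ≠ l'`), then `|⟨S, ⟨n,n,n⟩⟩|² ≤ r · ‖S‖²`: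
`r` orthogonal products capture at most `r` of the `n³` units of `⟨n,n,n⟩`, for every `n, r` (calibration
`Λ = r` on orthonormal frames; contains `RankTwoAdditivity` on orthogonal pairs).  Weighted Cauchy–Schwarz over
`(a, l)` with weights `N_l = ‖u_l‖²‖v_l‖²`, Pythagoras (`sepMajorantOFA_pythagoras`) on each output slice, and
the single-product law. [folklore] -/
theorem stub_orthogonalFrameAdditivity {n r : ℕ} (w u v : Fin r → Fin n × Fin n → ℂ)
    (horth : ∀ l l' : Fin r, l ≠ l' →
      (∑ b, conj (u l b) * u l' b) * (∑ c, conj (v l c) * v l' c) = 0) :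
    ‖∑ a, ∑ b, ∑ c, (∑ l, w l a * u l b * v l c) * matMulTensor ℂ n n n a b c‖ ^ 2 ≤
      (r : ℝ) * ∑ a, ∑ b, ∑ c, ‖∑ l, w l a * u l b * v l c‖ ^ 2 := by
  -- adapted from `stub_frameConditioningLaw` (A = 1, the frame hypothesis replaced by Pythagoras)
  obtain ⟨t, ht⟩ : ∃ t : Fin r → Fin n × Fin n → ℂ,
      ∀ l a, t l a = ∑ m : Fin n, u l (a.1, m) * v l (m, a.2) := ⟨_, fun _ _ => rfl⟩
  obtain ⟨N, hN⟩ : ∃ N : Fin r → ℝ, ∀ l, N l = (∑ b, ‖u l b‖ ^ 2) * ∑ c, ‖v l c‖ ^ 2 :=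
    ⟨_, fun _ => rfl⟩
  have hN0 : ∀ l, 0 ≤ N l := fun l => by rw [hN]; positivity
  have hsingle : ∀ l, ∑ a, ‖t l a‖ ^ 2 ≤ N l := fun l => by
    have h := sepMajorant_singleProductLaw (u l) (v l)
    simp_rw [sepMajorant_product_slice] at h
    simp_rw [ht, hN]
    exact h
  have htzero : ∀ l a, N l = 0 → t l a = 0 := fun l a h => by
    rw [ht, ← sepMajorant_product_slice (u l) (v l) a]
    exact sepMajorant_product_slice_eq_zero (u l) (v l) ((hN l).symm.trans h) a
  have hterm : ∀ l a, (‖w l a‖ * ‖t l a‖) ^ 2 ≤ ‖w l a‖ ^ 2 * N l * (‖t l a‖ ^ 2 / N l) := by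
    intro l a
    rcases eq_or_ne (N l) 0 with h0 | h0
    · simp [htzero l a h0]
    · refine le_of_eq ?_
      field_simp
  have hinner : ∀ a, (∑ l, ‖w l a‖ * ‖t l a‖) ^ 2 ≤
      (∑ l, ‖w l a‖ ^ 2 * N l) * ∑ l, ‖t l a‖ ^ 2 / N l := fun a =>
    Finset.sum_sq_le_sum_mul_sum_of_sq_le_mul Finset.univ
      (fun l _ => mul_nonneg (sq_nonneg _) (hN0 l)) (fun l _ => div_nonneg (sq_nonneg _) (hN0 l))
      (fun l _ => hterm l a)
  have houter : (∑ a, ∑ l, ‖w l a‖ * ‖t l a‖) ^ 2 ≤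
      (∑ a, ∑ l, ‖w l a‖ ^ 2 * N l) * ∑ a, ∑ l, ‖t l a‖ ^ 2 / N l :=
    Finset.sum_sq_le_sum_mul_sum_of_sq_le_mul Finset.univ
      (fun a _ => Finset.sum_nonneg fun l _ => mul_nonneg (sq_nonneg _) (hN0 l))
      (fun a _ => Finset.sum_nonneg fun l _ => div_nonneg (sq_nonneg _) (hN0 l))
      (fun a _ => hinner a)
  -- Pythagoras on each output slice, summed over `a`: `Σ_{a,l} |w_l(a)|² N_l = ‖S‖²`
  have hF : ∑ a, ∑ l, ‖w l a‖ ^ 2 * N l = ∑ a, ∑ b, ∑ c, ‖∑ l, w l a * u l b * v l c‖ ^ 2 := by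
    refine Finset.sum_congr rfl fun a _ => ?_
    simp only [hN]
    exact (sepMajorantOFA_pythagoras (fun l => w l a) u v horth).symm
  have hG : ∑ a, ∑ l, ‖t l a‖ ^ 2 / N l ≤ (r : ℝ) := by
    rw [Finset.sum_comm]
    calc ∑ l, ∑ a, ‖t l a‖ ^ 2 / N l = ∑ l, (∑ a, ‖t l a‖ ^ 2) / N l := by
          simp_rw [Finset.sum_div]
      _ ≤ ∑ _l : Fin r, (1 : ℝ) :=
          Finset.sum_le_sum fun l _ => div_le_one_of_le₀ (hsingle l) (hN0 l)
      _ = r := by simp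
  have hpair : (∑ a, ∑ b, ∑ c, (∑ l, w l a * u l b * v l c) * matMulTensor ℂ n n n a b c) =
      ∑ a, ∑ l, w l a * t l a := by
    rw [sepMajorant_frame_pairing]
    simp only [ht]
  have hnorm : ‖∑ a, ∑ l, w l a * t l a‖ ≤ ∑ a, ∑ l, ‖w l a‖ * ‖t l a‖ :=
    calc ‖∑ a, ∑ l, w l a * t l a‖ ≤ ∑ a, ‖∑ l, w l a * t l a‖ := norm_sum_le _ _
      _ ≤ ∑ a, ∑ l, ‖w l a * t l a‖ := Finset.sum_le_sum fun a _ => norm_sum_le _ _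
      _ = ∑ a, ∑ l, ‖w l a‖ * ‖t l a‖ := by simp_rw [norm_mul]
  have hS0 : 0 ≤ ∑ a, ∑ b, ∑ c, ‖∑ l, w l a * u l b * v l c‖ ^ 2 :=
    Finset.sum_nonneg fun a _ => Finset.sum_nonneg fun b _ => Finset.sum_nonneg fun c _ => sq_nonneg _
  calc ‖∑ a, ∑ b, ∑ c, (∑ l, w l a * u l b * v l c) * matMulTensor ℂ n n n a b c‖ ^ 2
      = ‖∑ a, ∑ l, w l a * t l a‖ ^ 2 := by rw [hpair]
    _ ≤ (∑ a, ∑ l, ‖w l a‖ * ‖t l a‖) ^ 2 := pow_le_pow_left₀ (norm_nonneg _) hnorm 2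
    _ ≤ (∑ a, ∑ l, ‖w l a‖ ^ 2 * N l) * ∑ a, ∑ l, ‖t l a‖ ^ 2 / N l := houter
    _ = (∑ a, ∑ b, ∑ c, ‖∑ l, w l a * u l b * v l c‖ ^ 2) * ∑ a, ∑ l, ‖t l a‖ ^ 2 / N l := by
        rw [hF]
    _ ≤ (∑ a, ∑ b, ∑ c, ‖∑ l, w l a * u l b * v l c‖ ^ 2) * r :=
        mul_le_mul_of_nonneg_left hG hS0
    _ = (r : ℝ) * ∑ a, ∑ b, ∑ c, ‖∑ l, w l a * u l b * v l c‖ ^ 2 := mul_comm _ _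

end Summit.MatrixMultiplication.MatrixMultiplication.Theorems
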